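import Mathlib
import Summits.Ventures.HodgeRepro.Tier4.Line1.RTFSetting

/-!
# Support of a non-zero orbital term (C-L4-ORBSUPP)

Tier 4, line L4 (C-L4-TAIL): the SUPPORT LEMMA both the sparsity clause (S1) and the count clause
(S2′) consume — a non-zero orbital term `S.orbital χ χ' o f ≠ 0` exhibits a rational representative
`γ` of the orbit `o` and torus points `t ∈ T`, `t' ∈ T'` with `t * γ * t'` in the support of the
test function `f`.  It is the contrapositive of the line's glue `orbital_eq_zero_of_not_mem`
(`Line1.RTFSetting`): the orbital integral over the fundamental domains `DT × DT'` of a function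
vanishing on the orbit's `T × T'`-saturation is `0`.

Forms landed (namespace `Line4`, all over a generic `S : Setting G`):
* `Setting.mem_geoSupport_of_orbital_ne_zero` — `o ∈ S.geoSupport f`;
* `Setting.exists_rep_of_orbital_ne_zero` — the representative over the fundamental domains
  (`t ∈ DT`, `t' ∈ DT'`, `f (t⁻¹ γ t') ≠ 0`), the sharpest form;
* `Setting.exists_mem_support_of_orbital_ne_zero` / `Setting.exists_mem_tsupport_of_orbital_ne_zero`
  — the lead's shape `∃ t ∈ T, ∃ t' ∈ T', t * γ * t' ∈ tsupport f` (R-23);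
* `Setting.support_conv_subset` — the support of a convolution `S.conv f₁ f₂` lies in the pointwise
  product `support f₁ * support f₂` (no measurability needed);
* `Setting.tsupport_conv_subset` — the closed-support form for compactly supported tests on a
  Hausdorff group;
* `Setting.exists_rep_of_orbital_conv_ne_zero` — the level-family form: for `f = S.conv f₁ f₂`
  a representative with `f₁ h ≠ 0` and `f₂ (h⁻¹ t⁻¹ γ t') ≠ 0`.

No printed input. HC_CM is NOT proved by anyone in this repository.
-/

namespace Summit.Ventures.HodgeRepro.Tier4.Line4

open MeasureTheory Topology Summit.Ventures.HodgeRepro.Tier4.Line1.RTF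
open scoped Pointwise

variable {G : Type} [Group G] [TopologicalSpace G] [MeasurableSpace G] (S : Setting G)

/-- A non-zero orbital term puts its orbit in the geometric support of the test. -/
theorem Setting.mem_geoSupport_of_orbital_ne_zero (χ : S.T → ℂ) (χ' : S.T' → ℂ) {f : G → ℂ}
    {o : S.Orbit} (h : S.orbital χ χ' o f ≠ 0) : o ∈ S.geoSupport f := by
  by_contra ho
  exact h (S.orbital_eq_zero_of_not_mem χ χ' ho)

/-- SUPPORT LEMMA, sharpest form: a non-zero orbital term exhibits a rational representative `γ`
of `o` and points `t ∈ DT`, `t' ∈ DT'` of the fundamental domains with `f (t⁻¹ γ t') ≠ 0`. -/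
theorem Setting.exists_rep_of_orbital_ne_zero (χ : S.T → ℂ) (χ' : S.T' → ℂ) {f : G → ℂ}
    {o : S.Orbit} (h : S.orbital χ χ' o f ≠ 0) :
    ∃ γ : S.Gk, S.orbitOf γ = o ∧ ∃ t ∈ S.DT, ∃ t' ∈ S.DT', f ((t : G)⁻¹ * γ * t') ≠ 0 := by
  obtain ⟨t, ht, t', ht', γ, hγ, hne⟩ := Setting.mem_geoSupport_of_orbital_ne_zero S χ χ' h
  exact ⟨γ, hγ, t, ht, t', ht', hne⟩

/-- SUPPORT LEMMA (R-23 shape, open support): `S.orbital χ χ' o f ≠ 0 → ∃ γ, S.orbitOf γ = o ∧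
∃ t ∈ T, ∃ t' ∈ T', t * γ * t' ∈ support f`. -/
theorem Setting.exists_mem_support_of_orbital_ne_zero (χ : S.T → ℂ) (χ' : S.T' → ℂ) {f : G → ℂ}
    {o : S.Orbit} (h : S.orbital χ χ' o f ≠ 0) :
    ∃ γ : S.Gk, S.orbitOf γ = o ∧ ∃ t ∈ S.T, ∃ t' ∈ S.T', t * γ * t' ∈ Function.support f := by
  obtain ⟨γ, hγ, t, _, t', _, hne⟩ := Setting.exists_rep_of_orbital_ne_zero S χ χ' h
  exact ⟨γ, hγ, (t : G)⁻¹, S.T.inv_mem t.2, t', t'.2, Function.mem_support.mpr hne⟩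

/-- SUPPORT LEMMA (R-23 shape): `S.orbital χ χ' o f ≠ 0 → ∃ γ, S.orbitOf γ = o ∧
∃ t ∈ T, ∃ t' ∈ T', t * γ * t' ∈ tsupport f`. -/
theorem Setting.exists_mem_tsupport_of_orbital_ne_zero (χ : S.T → ℂ) (χ' : S.T' → ℂ) {f : G → ℂ}
    {o : S.Orbit} (h : S.orbital χ χ' o f ≠ 0) :
    ∃ γ : S.Gk, S.orbitOf γ = o ∧ ∃ t ∈ S.T, ∃ t' ∈ S.T', t * γ * t' ∈ tsupport f := by
  obtain ⟨γ, hγ, t, ht, t', ht', hmem⟩ := Setting.exists_mem_support_of_orbital_ne_zero S χ χ' h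
  exact ⟨γ, hγ, t, ht, t', ht', subset_tsupport f hmem⟩

/-- The support of a convolution lies in the pointwise product of the supports:
`S.conv f₁ f₂ g ≠ 0 → ∃ h, f₁ h ≠ 0 ∧ f₂ (h⁻¹ * g) ≠ 0` (no measurability needed: an integrand
that vanishes identically integrates to `0`). -/
theorem Setting.support_conv_subset (f₁ f₂ : G → ℂ) :
    Function.support (S.conv f₁ f₂) ⊆ Function.support f₁ * Function.support f₂ := by
  intro g hg
  rw [Function.mem_support] at hg
  by_contra hn
  apply hg
  unfold Setting.conv
  have hz : (fun h => f₁ h * f₂ (h⁻¹ * g)) = 0 := by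
    funext h
    by_contra hne
    apply hn
    rw [Pi.zero_apply] at hne
    exact ⟨h, left_ne_zero_of_mul hne, h⁻¹ * g, right_ne_zero_of_mul hne, mul_inv_cancel_left h g⟩
  rw [hz]
  simp

/-- Pointwise form of `support_conv_subset`. -/
theorem Setting.exists_of_conv_ne_zero (f₁ f₂ : G → ℂ) {g : G} (h : S.conv f₁ f₂ g ≠ 0) :
    ∃ h₁ : G, f₁ h₁ ≠ 0 ∧ f₂ (h₁⁻¹ * g) ≠ 0 := by
  obtain ⟨h₁, hh₁, h₂, hh₂, rfl⟩ := Setting.support_conv_subset S f₁ f₂ (Function.mem_support.mpr h)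
  exact ⟨h₁, hh₁, by rwa [inv_mul_cancel_left]⟩

/-- The closed support of a convolution of compactly supported tests on a Hausdorff topological
group lies in the product of the closed supports. -/
theorem Setting.tsupport_conv_subset [IsTopologicalGroup G] [T2Space G] {f₁ f₂ : G → ℂ}
    (h₁ : HasCompactSupport f₁) (h₂ : HasCompactSupport f₂) :
    tsupport (S.conv f₁ f₂) ⊆ tsupport f₁ * tsupport f₂ := by
  have hcl : IsClosed (tsupport f₁ * tsupport f₂) := (h₁.mul h₂).isClosed
  refine (closure_minimal ?_ hcl)
  refine (Setting.support_conv_subset S f₁ f₂).trans ?_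
  exact Set.mul_subset_mul (subset_tsupport f₁) (subset_tsupport f₂)

/-- SUPPORT LEMMA for a convolution test (the level family `f N = S.conv f₁ (f₂ N)`): a non-zero
orbital term exhibits a representative `γ` of `o`, torus points `t ∈ DT`, `t' ∈ DT'` and a factor
`h` with `f₁ h ≠ 0` and `f₂ (h⁻¹ t⁻¹ γ t') ≠ 0`. -/
theorem Setting.exists_rep_of_orbital_conv_ne_zero (χ : S.T → ℂ) (χ' : S.T' → ℂ) {f₁ f₂ : G → ℂ}
    {o : S.Orbit} (h : S.orbital χ χ' o (S.conv f₁ f₂) ≠ 0) :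
    ∃ γ : S.Gk, S.orbitOf γ = o ∧ ∃ t ∈ S.DT, ∃ t' ∈ S.DT', ∃ h₁ : G, f₁ h₁ ≠ 0 ∧
      f₂ (h₁⁻¹ * ((t : G)⁻¹ * γ * t')) ≠ 0 := by
  obtain ⟨γ, hγ, t, ht, t', ht', hne⟩ := Setting.exists_rep_of_orbital_ne_zero S χ χ' h
  obtain ⟨h₁, hh₁, hh₂⟩ := Setting.exists_of_conv_ne_zero S f₁ f₂ hne
  exact ⟨γ, hγ, t, ht, t', ht', h₁, hh₁, hh₂⟩

end Summit.Ventures.HodgeRepro.Tier4.Line4
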